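import Summits.ResolutionOfSingularities.ResolutionOfSingularities.Theorems.MarkedTransferCampaignW46OurProcedure
import Summits.ResolutionOfSingularities.ResolutionOfSingularities.Theorems.MarkedTransferCampaignW46ThreefoldsSigmaCurveStep
import HarnessLib

/-!
# [OURS · L1 W4.6 rung (i-i)] USELESS PROCRASTINATION IS THE ONLY OBSTRUCTION ON SURFACES: every infinite §2.1-permissible
# sequence on surfaces blows up, infinitely often, a point of a singular curve at which every singular curve is regular
# (cell res-hironaka, LADDER-RESOLUTION rung L, D-0089; campaign s46, prover res-L1-s46-pv-1; host route MarkedTransfer,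
# `--supports stmt-ResolutionOfSingularities-16155`)

HONEST FRAMING. Nothing here is a statement of H. Hironaka's manuscript (2017-03-23, [Hironaka2017]) and nothing here
asserts that any statement of it holds. OURS objects and tree geometry only; résumé-free. AI-written; weaker than
expert review. No `sorry`; axioms standard.

## What (sharpening rungs (i-b)/(i-c) p526033/p528373 and (i-h) p539260/p540391)

A step of a §2.1-permissible sequence on a surface is a USELESS PROCRASTINATION (`UselessProcrastination E D`) if its
centre is a closed point `ξ` lying on a singular curve of `E` (it procrastinates, `CentreProcrastinates`) while NO singular
curve of `E` is singular at `ξ` (it is not a good procrastination, `CentreGoodProcrastination`, p540391). We prove: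

* `exists_hasCurveFamily_transform_le` — **the measure `Δ` (total `δ`-invariant of the prime divisors of `V(J)`, rung
  (ii-2)'s `familyDelta`, res-L1-s46-pv-11) NEVER INCREASES along a §2.1-permissible step between surface states**: a
  curve centre or a codimension-one point centre is an effective Cartier divisor, the blow-up an isomorphism and the prime
  divisors of `V(J′) ⊆ π⁻¹V(J)` a sub-family (`exists_hasCurveFamily_le_of_isIso`); a point centre of codimension `≠ 1`
  is rung (ii-2)'s `exists_family_pointBlowup` (strict transforms do not raise `Σδ`, the exceptional curve has `δ = 0`);
  and it DROPS at good procrastinations (`exists_hasCurveFamily_transform_lt`, p540391);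
* **`PermissibleRun.exists_uselessProcrastination_ge`** — RUNG (i-i): every infinite §2.1-permissible sequence all of
  whose stages are surfaces (every field `K : Type` of characteristic `p`) makes useless procrastinations beyond every stage (by rung (i-c) it
  procrastinates infinitely often; were all late procrastinations good, `Δ ∈ ℕ∞` would drop infinitely often while never
  increasing);
* `planeNoUselessProcrastinationTerminates_holds` — equivalently: NO infinite surface sequence avoids useless
  procrastinations from some stage on; this contains rung (i-b) (`…of_nonProcrastinating`) and the termination of OUR
  procedure for all choices (`planeOurProcedureTerminates_of_noUseless`), now WITHOUT the phase discipline: honest steps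
  and good procrastinations may be interleaved at will.

## References

* J. Kollár, Lectures on Resolution of Singularities (2007), §1.4. [Kollar2007]
* R. Hartshorne, Algebraic Geometry (1977), Ch. V Prop. 3.8, Thm. 3.9. [Hartshorne1977]
* H. Hironaka, ms. 2017-03-23, §2.1 p.4 l.34–39, Th. 16.13 p.87 l.26–28 — scope only, under adjudication, not cited
  as fact. [Hironaka2017]
-/

noncomputable section

set_option linter.dupNamespace false -- mandated namespace of this single-conjunct summit

open CategoryTheory AlgebraicGeometry TopologicalSpace IsLocalRing

namespace Summit.ResolutionOfSingularities.ResolutionOfSingularities.Theorems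

namespace CampaignW46

open Literature.AlgebraicGeometry.Resolution
open Literature.AlgebraicGeometry.Hironaka2017.S02Preliminaries
open Literature.AlgebraicGeometry.Hironaka2017.Datum
open Scheme.IdealSheafData

universe u

variable {p : ℕ} [Fact p.Prime] {K : Type u} [Field K] [CharP K p]

/-! ## `Δ` along a sub-family and along an isomorphism -/

/-- `familyDelta` does not go up under `≤` member by member, the new members having `Σδ = 0`. [folklore] -/
theorem familyDelta_le_of_inl_le {ι σ : Type} [Finite ι] [Finite σ] (C : ι → Scheme.{u}) [∀ k, IsIntegral (C k)]
    (C' : ι ⊕ σ → Scheme.{u}) [∀ k', IsIntegral (C' k')]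
    (hle : ∀ k, ∑ᶠ c, pointDelta (C' (Sum.inl k)) c ≤ ∑ᶠ c, pointDelta (C k) c)
    (hE : ∀ s, ∑ᶠ c, pointDelta (C' (Sum.inr s)) c = 0) : familyDelta C' ≤ familyDelta C := by
  classical
  haveI := Fintype.ofFinite ι
  rw [familyDelta_def, familyDelta_def, finsum_sum_type, finsum_eq_zero_of_forall_eq_zero hE, add_zero,
    finsum_eq_sum_of_fintype, finsum_eq_sum_of_fintype]
  exact Finset.sum_le_sum fun k _ => hle k

/-- `familyDelta` of a sub-family (re-indexed along an injection) is at most `familyDelta`. [folklore] -/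
theorem familyDelta_comp_le_of_injective {ι ι' : Type} [Finite ι] [Finite ι'] (C : ι → Scheme.{u})
    [∀ k, IsIntegral (C k)] (f : ι' → ι) (hf : Function.Injective f) :
    @familyDelta ι' (fun k' => C (f k')) (fun _ => inferInstance) ≤ familyDelta C := by
  classical
  haveI := Fintype.ofFinite ι
  haveI := Fintype.ofFinite ι'
  rw [familyDelta_def, familyDelta_def, finsum_eq_sum_of_fintype, finsum_eq_sum_of_fintype]
  calc ∑ k' : ι', ∑ᶠ c, pointDelta (C (f k')) c
      = ∑ k ∈ Finset.univ.image f, ∑ᶠ c, pointDelta (C k) c := by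
        rw [Finset.sum_image fun a _ b _ h => hf h]
    _ ≤ ∑ k : ι, ∑ᶠ c, pointDelta (C k) c :=
        Finset.sum_le_sum_of_subset_of_nonneg (Finset.subset_univ _) fun _ _ _ => zero_le

/-- **Along an ISOMORPHISM of ambient data `Δ` does not go up**: the prime divisors of `V(J′)`, `J′ ⊇ J𝒪_{Z′}` the ideal
of the transform, lie over prime divisors of `V(J)`, and the corresponding members transported along `π⁻¹` present
them. [folklore] -/
theorem exists_hasCurveFamily_le_of_isIso (A A' : AmbientDatum p K) (E : IdealExponent A.Z) (D : Closeds A.Z)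
    {π : A'.Z ⟶ A.Z} [IsIso π] {n : ℕ∞} (hF : HasCurveFamily A.Z E.J n) :
    ∃ n', n' ≤ n ∧ HasCurveFamily A'.Z (E.transform π D).J n' := by
  classical
  obtain ⟨ι, hι, ζ, C, i, hfam, hζinj, hrange, hn⟩ := hF
  haveI hint : ∀ k, IsIntegral (C k) := fun k => (hfam k).2.1
  haveI hci : ∀ k, IsClosedImmersion (i k) := fun k => (hfam k).1
  set J' := (E.transform π D).J with hJ'
  -- prime divisors of `V(J′)` lie over prime divisors of `V(J)`
  have hover : ∀ ζ' ∈ divisorialPoints J', π ζ' ∈ divisorialPoints E.J := by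
    intro ζ' hζ'
    refine ⟨?_, ?_⟩
    · have h1 : ζ' ∈ ((E.J.comap π).support : Set A'.Z) :=
        Scheme.IdealSheafData.support_antitone (comap_le_controlledTransform π (vanishingIdeal D) E.J E.b) hζ'.1
      rw [Scheme.IdealSheafData.support_comap] at h1
      exact h1
    · rw [← coheight_eq_of_isIso_stalkMap π ζ']
      exact hζ'.2
  -- the sub-family of members whose transported generic point is a prime divisor of `V(J′)`
  let P : ι → Prop := fun k => (inv π) (ζ k) ∈ divisorialPoints J'
  let ι' := {k : ι // P k}
  haveI : Finite ι' := Subtype.finite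
  have hππ : ∀ z : A'.Z, (inv π) (π z) = z := fun z => by
    rw [← Scheme.Hom.comp_apply, IsIso.hom_inv_id]; rfl
  have hπinv : ∀ y : A.Z, π ((inv π) y) = y := fun y => by
    rw [← Scheme.Hom.comp_apply, IsIso.inv_hom_id]; rfl
  have hfam' : ∀ k' : ι', IsClosedImmersion (i k'.1 ≫ inv π) ∧
      ∃ (_ : IsIntegral (C k'.1)) (_ : IsNoetherian (C k'.1)), Scheme.IsQuasiExcellent (C k'.1) ∧
        topologicalKrullDim (C k'.1) ≤ 1 ∧ (i k'.1 ≫ inv π) (genericPoint (C k'.1)) = (inv π) (ζ k'.1) := by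
    intro k'
    obtain ⟨_, hI, hN, hq, hd, hg⟩ := hfam k'.1
    exact ⟨inferInstance, hI, hN, hq, hd, by rw [Scheme.Hom.comp_apply, hg]⟩
  refine ⟨@familyDelta ι' (fun k' => C k'.1) (fun k' => inferInstance), ?_, ι', inferInstance,
    fun k' => (inv π) (ζ k'.1), fun k' => C k'.1, fun k' => i k'.1 ≫ inv π, hfam', ?_, ?_, rfl⟩
  · rw [← hn]
    exact familyDelta_comp_le_of_injective C (fun k' : ι' => k'.1) Subtype.val_injective
  · intro a b h
    apply Subtype.ext
    apply hζinj
    have := congrArg (fun z => π z) h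
    simpa [hπinv] using this
  · ext ζ'
    constructor
    · rintro ⟨k', rfl⟩
      exact k'.2
    · intro hζ'
      have hmem : π ζ' ∈ Set.range ζ := hrange ▸ hover ζ' hζ'
      obtain ⟨k, hk⟩ := hmem
      have hk' : (inv π) (ζ k) = ζ' := by rw [hk, hππ]
      exact ⟨⟨k, show P k by rw [show P k ↔ (inv π) (ζ k) ∈ divisorialPoints J' from Iff.rfl, hk']; exact hζ'⟩, hk'⟩

/-! ## `Δ` never increases along a permissible step on a surface -/

/-- **`Δ` DOES NOT INCREASE along any §2.1-permissible step between surface states.** For a standard `E` on an ambient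
datum of dimension `≤ 2`, a §2.1-permissible centre `D` and a blowing up `π` along `𝓘_D`: every curve family of `V(J)`
of total `δ`-invariant `n` yields one of `V(J′)` of total `δ`-invariant `≤ n`. Cases: the generic point of `D` has
codimension one (a regular singular curve, or a codimension-one closed point) — `𝓘_D` is Cartier, `π` an isomorphism
(`isIso_of_curveCentre`); or `D` is a closed point of codimension `≠ 1` — rung (ii-2)'s `exists_family_pointBlowup`
(res-L1-s46-pv-11). [cite: Kollar2007, §1.4] -/
theorem exists_hasCurveFamily_transform_le (A A' : AmbientDatum p K) (E : IdealExponent A.Z) (hE : E.IsStandard)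
    (hdimZ : topologicalKrullDim A.Z ≤ 2) {D : Closeds A.Z} (hD : E.IsPermissibleCentre A.hom D) {π : A'.Z ⟶ A.Z}
    (hπ : IsBlowup π (vanishingIdeal D)) {n : ℕ∞} (hF : HasCurveFamily A.Z E.J n) :
    ∃ n', n' ≤ n ∧ HasCurveFamily A'.Z (E.transform π D).J n' := by
  classical
  haveI := ambient_isIntegral A
  haveI := AmbientDatum.isNoetherian_ambient A
  have hZreg : Scheme.IsRegular A.Z := ambient_isRegular A
  have hXq : Scheme.IsQuasiExcellent A.Z := (AmbientDatum.isExcellent_Z A).isQuasiExcellent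
  obtain ⟨ζ₀, hζ₀⟩ : ∃ ζ₀ : A.Z, IsGenericPoint ζ₀ (D : Set A.Z) :=
    ⟨_, hD.irreducible.isGenericPoint_genericPoint D.isClosed⟩
  by_cases hcoh : Order.coheight ζ₀ = 1
  · -- Cartier centre: `π` is an isomorphism
    haveI : IsIso π := isIso_of_curveCentre A A' hζ₀ hcoh hπ
    exact exists_hasCurveFamily_le_of_isIso A A' E D hF
  · -- a closed point of codimension `≠ 1`
    have hζ₀cl : IsClosed ({ζ₀} : Set A.Z) := by
      by_contra hncl
      exact hcoh (coheight_eq_one_of_not_isClosed A hE hdimZ hD hζ₀ hncl)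
    have hDeq : (D : Set A.Z) = {ζ₀} := hζ₀.def.symm.trans hζ₀cl.closure_eq
    obtain rfl : D = ⟨{ζ₀}, hζ₀cl⟩ := Closeds.ext hDeq
    have hζ₀div : ζ₀ ∉ divisorialPoints E.J := fun h => hcoh h.2
    have hζ₀ne : ({ζ₀} : Set A.Z) ≠ Set.univ := ne_univ_of_subset_sing A hE hD.subset_sing
    obtain ⟨ι, hι, ζ, C, i, hfam, hζinj, hrange, hn⟩ := hF
    haveI hint : ∀ k, IsIntegral (C k) := fun k => (hfam k).2.1
    obtain ⟨ζ', C', i', hinj', hrange', hfam', -, -, hδ, hδE⟩ :=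
      exists_family_pointBlowup hZreg hXq hdimZ hζ₀cl hζ₀ne hπ E.J E.b hζ₀div ζ C i hζinj hrange hfam
    haveI hint' : ∀ k', IsIntegral (C' k') := fun k' => (hfam' k').2.1
    refine ⟨@familyDelta _ C' (fun k' => (hfam' k').2.1), ?_, _, inferInstance, ζ', C', i', hfam', hinj', hrange', rfl⟩
    rw [← hn]
    exact familyDelta_le_of_inl_le C C' (fun k => (hδ k (hint' _) (hint k)).1) fun s => hδE s (hint' _)

/-! ## Useless procrastinations -/

/-- [OURS · L1 W4.6 rung (i-i)] NOT a statement of the manuscript. **The centre `D` is a USELESS PROCRASTINATION for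
`E`**: it procrastinates (a closed point on a singular curve of `E`) but is not a good procrastination (no singular curve
of `E` is singular there). [folklore] -/
def UselessProcrastination {Z : Scheme.{u}} (E : IdealExponent Z) (D : Closeds Z) : Prop :=
  CentreProcrastinates E D ∧ ¬ CentreGoodProcrastination E D

/-- A centre obeying OUR rule is not a useless procrastination. [folklore] -/
theorem not_uselessProcrastination_of_ourCentre (A : AmbientDatum p K) {E : IdealExponent A.Z} {D : Closeds A.Z}
    (h : OurCentre A E D) : ¬ UselessProcrastination E D := by
  rintro ⟨hp, hng⟩
  rcases h with hg | ⟨-, hnp⟩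
  · exact hng hg
  · exact hnp hp

/-! ## Rung (i-i): every infinite surface sequence makes useless procrastinations forever -/

section Run

variable {K : Type} [Field K] [CharP K p]

/-- Along a permissible surface sequence a curve family propagates forward without increase of `Δ`. [folklore] -/
theorem PermissibleRun.exists_hasCurveFamily_add_le (r : PermissibleRun p K) (hdim : ∀ k, Regime.dimLE 2 (r.A k) (r.E k))
    (k : ℕ) {n : ℕ∞} (hF : HasCurveFamily (r.A k).Z (r.E k).J n) (m : ℕ) :
    ∃ n', n' ≤ n ∧ HasCurveFamily (r.A (k + m)).Z (r.E (k + m)).J n' := by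
  induction m with
  | zero => exact ⟨n, le_rfl, hF⟩
  | succ m ih =>
    obtain ⟨n₁, hn₁, hF₁⟩ := ih
    obtain ⟨n₂, hn₂, hF₂⟩ := exists_hasCurveFamily_transform_le (r.A (k + m)) (r.A (k + m + 1)) (r.E (k + m))
      (r.standard _) (hdim _) (r.permissible _) (r.blowup _) hF₁
    rw [← r.E_succ (k + m)] at hF₂
    exact ⟨n₂, hn₂.trans hn₁, hF₂⟩

/-- [OURS · L1 W4.6 rung (i-i)] NOT a statement of the manuscript. **RUNG (i-i) — «USELESS PROCRASTINATION IS THE ONLY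
OBSTRUCTION ON SURFACES».** Over every field `K : Type` of characteristic `p`: every infinite §2.1-permissible sequence (standard ideal
exponents, permissible centres, blow-ups, transforms of Def. 2.1) all of whose stages have dimension `≤ 2` makes, beyond
every stage `k₀`, a USELESS procrastination — it blows up a closed point of a singular curve of `E_k` at which every
singular curve of `E_k` is regular. Sharpens rung (i-c) («procrastinates beyond every stage», p528373): good
procrastinations and honest steps, interleaved at will, never go on forever. Proof: `Δ` never increases
(`exists_hasCurveFamily_transform_le`), drops at every good procrastination (`exists_hasCurveFamily_transform_lt`), and
procrastinations recur (rung (i-c)); well-foundedness of `ℕ∞`. [cite: Kollar2007, §1.4] -/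
theorem PermissibleRun.exists_uselessProcrastination_ge (r : PermissibleRun p K)
    (hdim : ∀ k, Regime.dimLE 2 (r.A k) (r.E k)) (k₀ : ℕ) :
    ∃ k, k₀ ≤ k ∧ UselessProcrastination (r.E k) (r.D k) := by
  by_contra hnone
  push Not at hnone
  -- beyond `k₀` every procrastinating step is a good procrastination
  have hgood : ∀ k, k₀ ≤ k → r.Procrastinates k → CentreGoodProcrastination (r.E k) (r.D k) := by
    intro k hk hproc
    by_contra hng
    exact hnone k hk ⟨(r.procrastinates_iff k).mp hproc, hng⟩
  -- no stage beyond `k₀` carries a curve family: induction on its total `δ`-invariant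
  have key : ∀ (n : ℕ∞) (k : ℕ), k₀ ≤ k → ¬ HasCurveFamily (r.A k).Z (r.E k).J n := by
    intro n
    induction n using WellFoundedLT.induction with
    | _ n ih =>
    intro k hk hF
    -- the next procrastination, at `k₁ = k + m`
    obtain ⟨k₁, hk₁, hproc⟩ := r.exists_procrastinates_ge hdim k
    obtain ⟨m, rfl⟩ := Nat.exists_eq_add_of_le hk₁
    obtain ⟨n₁, hn₁, hF₁⟩ := r.exists_hasCurveFamily_add_le hdim k hF m
    -- it is good: `Δ` drops
    obtain ⟨n₂, hn₂, hF₂⟩ := exists_hasCurveFamily_transform_lt (r.A (k + m)) (r.A (k + m + 1)) (r.E (k + m))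
      (r.standard _) (hdim _) (hgood (k + m) (hk.trans hk₁) hproc) (r.blowup _) hF₁
    rw [← r.E_succ (k + m)] at hF₂
    exact ih n₂ (hn₂.trans_le hn₁) (k + m + 1) (by omega) hF₂
  obtain ⟨n₀, hF₀⟩ := exists_hasCurveFamily (r.A k₀) (r.standard k₀) (hdim k₀)
  exact key n₀ k₀ le_rfl hF₀

/-- [OURS · L1 W4.6 rung (i-i)] NOT a statement of the manuscript. **«NO infinite §2.1-permissible surface sequence avoids
useless procrastinations»** (from some stage on, hence in particular throughout). [folklore] -/
def PlaneNoUselessProcrastinationTerminates (p : ℕ) [Fact p.Prime] (K : Type u) [Field K] [CharP K p] : Prop :=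
  ∀ r : PermissibleRun p K, (∀ k, Regime.dimLE 2 (r.A k) (r.E k)) →
    (∃ k₀, ∀ k, k₀ ≤ k → ¬ UselessProcrastination (r.E k) (r.D k)) → False

/-- Rung (i-i) contains rung (i-b): a non-procrastinating step is not a useless procrastination. [folklore] -/
theorem planeNonProcrastinatingTerminates_of_noUseless (h : PlaneNoUselessProcrastinationTerminates p K) :
    PlaneNonProcrastinatingTerminates p K :=
  fun r hdim hnp => h r hdim ⟨0, fun k _ hu => hnp k ((r.procrastinates_iff k).mpr hu.1)⟩

/-- Rung (i-i) contains the termination of OUR procedure for all choices (p540391), without phase discipline.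
[folklore] -/
theorem planeOurProcedureTerminates_of_noUseless (h : PlaneNoUselessProcrastinationTerminates p K) :
    PlaneOurProcedureTerminates p K :=
  fun r hdim hour => h r hdim ⟨0, fun k _ => not_uselessProcrastination_of_ourCentre (r.A k) (hour k)⟩

/-- [OURS · L1 W4.6 rung (i-i)] NOT a statement of the manuscript. **RUNG (i-i) HOLDS** over every field `K : Type` of
characteristic `p` (perfectness is needed only for the EXISTENCE of steps, rung (i-h)). [cite: Kollar2007, §1.4] -/
theorem planeNoUselessProcrastinationTerminates_holds (p : ℕ) [Fact p.Prime] (K : Type) [Field K] [CharP K p] :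
    PlaneNoUselessProcrastinationTerminates p K := by
  rintro r hdim ⟨k₀, hk₀⟩
  obtain ⟨k, hk, hu⟩ := r.exists_uselessProcrastination_ge hdim k₀
  exact hk₀ k hk hu

end Run

end CampaignW46

end Summit.ResolutionOfSingularities.ResolutionOfSingularities.Theorems

end
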